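import Mathlib
import Summits.KontsevichZagierPeriods.Zeta5Search.Families.DualExactTwelve
import Summits.KontsevichZagierPeriods.Zeta5Search.Families.DualBaseChartsB
import HarnessLib
import HarnessLib.Audit

/-!
# ζ(5) search — Families: the coefficient family with an INTEGER `(1+v)`-exponent and `Gz = Φz` on `ℤ × ℕ⁶ × ℤ⁵`

HONEST FRAMING: systematic search; no irrationality claim unless certified.  Cell `pub-zeta5`, certifier 2
(cert-2 g8, 2026-08-22).  Identities between integers (coefficients of power series over `ℤ`); nothing about `ζ(5)`.

WHY.  On Brown–Zudilin's family the first exponent of the dictionary of `Families/DualQBridge` is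
`e₁ = h₂₇(a) = a₃+a₆+2a₇−a₁−a₂−a₅`, which is NEGATIVE on part of P2's cone `{bzNum ≥ 0, bzDen ≥ 0}` (e.g.
`a = (0,1,1,0,2,0,1,0)`).  There `|Q(a)|` is the coefficient of `(1+v)^{e₁}·(polynomial)` with `(1+v)^{e₁}` a unit of the
power-series ring.  This file extends both sides of the twelve-parameter identity to `e₁ ∈ ℤ`:

* `Gz e₁ e t = [x^t] (1+v)^{e₁} · F₂^{e₂}⋯F₇^{e₇}` in `ℤ[[z,z',v,y,y']]` (the slot `e 0` of `e` is ignored),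
  `Gz_natCast : Gz (e 0) e t = G e t`, and the Pascal relation in `e₁`: `Gz_succ`;
* `PhiZ e₁ e t` = the extended dual constant term with `e₁ ∈ ℤ` in the affine span exponents (`nExpZ`),
  `PhiZ_natCast : PhiZ (e 0) e t = Phi e t`, and the same relation `PhiZ_succ` (Plücker move `E_move0`);
* **`Gz_eq_PhiZ : Gz e₁ e t = PhiZ e₁ e t` for all `e₁ ∈ ℤ`**: for `e₁ ≥ 0` this is `G = Φ` (`DualExactTwelve` +
  `DualBaseChartsB.dualBaseIdentity_holds`); for `e₁ < 0` by induction on `−e₁` and on `t₁ + t₃` using the two relations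
  backwards (both sides vanish when `t₁ + t₃ < 0`).
-/

noncomputable section

open MvPowerSeries Finset

namespace Summit.KontsevichZagierPeriods.Zeta5Search.Families.Cellular

namespace DualR

open DualQ (G tUnit qPoly qFactor P5)

/-! ## The `Q` side with `e₁ ∈ ℤ` -/

/-- The unit `1 + v` of `ℤ[[z,z',v,y,y']]` (same coefficient ring `S5`; `v` is variable `2`). -/
def vUnit : S5ˣ :=
  ⟨1 + r 2, invOfUnit (1 + r 2) 1, mul_invOfUnit _ _ (by simp [r]), invOfUnit_mul _ _ (by simp [r])⟩

/-- The underlying series of `vUnit`. -/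
@[simp] theorem val_vUnit : ((vUnit : S5ˣ) : S5) = 1 + r 2 := rfl

/-- `cUnit` of `DualGapSeries` is `tUnit` of `DualQPolynomial`. -/
theorem cUnit_eq_tUnit (k : Fin 5) : cUnit k = tUnit k := rfl

/-- **`Gz e₁ e t = [x^t] (1+v)^{e₁} F₂^{e₂} ⋯ F₇^{e₇}`**, `e₁ ∈ ℤ` (the slot `e 0` is ignored). -/
def Gz (e₁ : ℤ) (e : Fin 7 → ℕ) (t : Fin 5 → ℤ) : ℤ :=
  coeffZ t (((vUnit ^ e₁ : S5ˣ) : S5) * ((qPoly (Function.update e 0 0) : P5) : S5))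

/-- `Gz` ignores the slot `e 0`. -/
theorem Gz_update0 (e₁ : ℤ) (e : Fin 7 → ℕ) (k : ℕ) (t : Fin 5 → ℤ) :
    Gz e₁ (Function.update e 0 k) t = Gz e₁ e t := by
  unfold Gz; rw [Function.update_idem]

/-- For `e₁ = e 0 ∈ ℕ`, `Gz` is the polynomial family `G`. -/
theorem Gz_natCast (e : Fin 7 → ℕ) (t : Fin 5 → ℤ) : Gz (e 0) e t = G e t := by
  have hv : ((vUnit ^ ((e 0 : ℕ) : ℤ) : S5ˣ) : S5) = ((qFactor 0 ^ e 0 : P5) : S5) := by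
    rw [zpow_natCast, Units.val_pow_eq_pow_val, val_vUnit, show qFactor 0 = 1 + MvPolynomial.X 2 from rfl,
      MvPolynomial.coe_pow]
    simp [r]
  have hprod : ((qFactor 0 ^ e 0 : P5) : S5) * ((qPoly (Function.update e 0 0) : P5) : S5) = ((qPoly e : P5) : S5) := by
    rw [← MvPolynomial.coe_mul]
    congr 1
    unfold qPoly
    simp only [Function.update_self, Function.update_of_ne, ne_eq, Fin.reduceEq, not_false_eq_true, pow_zero, one_mul]
    ring
  unfold Gz G DualQ.coeffZ coeffZ
  rw [hv, hprod]
  split_ifs <;> simp [MvPolynomial.coeff_coe]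

/-- `Gz` vanishes off the orthant. -/
theorem Gz_eq_zero_of_neg (e₁ : ℤ) (e : Fin 7 → ℕ) {t : Fin 5 → ℤ} {j : Fin 5} (hj : t j < 0) : Gz e₁ e t = 0 :=
  coeffZ_eq_zero_of_neg _ hj

/-- **Pascal in `e₁`**: `Gz(e₁+1) = Gz(e₁) + Gz(e₁)(t − u_v)` for every `e₁ ∈ ℤ`. -/
theorem Gz_succ (e₁ : ℤ) (e : Fin 7 → ℕ) (t : Fin 5 → ℤ) :
    Gz (e₁ + 1) e t = Gz e₁ e t + Gz e₁ e (t - tUnit 2) := by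
  unfold Gz
  rw [zpow_add_one, Units.val_mul, val_vUnit, show ∀ A P : S5, A * (1 + r 2) * P = A * P + r 2 * (A * P) from
    fun A P => by ring, coeffZ_add, coeffZ_X_mul, cUnit_eq_tUnit]

/-! ## The constant-term side with `e₁ ∈ ℤ` -/

/-- The ten span exponents with an integer first parameter `e₁` (slot `e 0` ignored). -/
def nExpZ (e₁ : ℤ) (e : Fin 7 → ℕ) (t : Fin 5 → ℤ) : Fin 10 → ℤ :=
  ![(e 4 : ℤ) + e 6 - t 1 - t 2, e 2, e₁ + t 0 + t 1 - e 1 - e 2, e 6, e 4, t 2 - t 3 - e₁ + e 2, e 3,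
    t 3 + t 4 + e₁ - e 3 - e 4, (e 3 : ℤ) + e 5 - t 0 - t 2, t 2 + e 1 - e₁ - t 4]

/-- **`PhiZ e₁ e t`**: the extended dual constant term with `e₁ ∈ ℤ`. -/
def PhiZ (e₁ : ℤ) (e : Fin 7 → ℕ) (t : Fin 5 → ℤ) : ℤ := coeffZ (cExp e t) (E (nExpZ e₁ e t) : S5)

/-- `nExpZ (e 0) e t = nExp e t`. -/
theorem nExpZ_natCast (e : Fin 7 → ℕ) (t : Fin 5 → ℤ) : nExpZ (e 0) e t = nExp e t := by
  ext k; fin_cases k <;> simp [nExpZ, nExp]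

/-- `PhiZ (e 0) e t = Phi e t`. -/
theorem PhiZ_natCast (e : Fin 7 → ℕ) (t : Fin 5 → ℤ) : PhiZ (e 0) e t = Phi e t := by
  unfold PhiZ Phi; rw [nExpZ_natCast]

/-- `nExpZ` ignores the slot `e 0`. -/
theorem nExpZ_update0 (e₁ : ℤ) (e : Fin 7 → ℕ) (k : ℕ) (t : Fin 5 → ℤ) :
    nExpZ e₁ (Function.update e 0 k) t = nExpZ e₁ e t := by
  ext j; fin_cases j <;> simp [nExpZ]

/-- `cExp` ignores the slot `e 0`. -/
theorem cExp_update0 (e : Fin 7 → ℕ) (k : ℕ) (t : Fin 5 → ℤ) : cExp (Function.update e 0 k) t = cExp e t := by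
  ext j; fin_cases j <;> simp [cExp]

/-- `PhiZ` ignores the slot `e 0`. -/
theorem PhiZ_update0 (e₁ : ℤ) (e : Fin 7 → ℕ) (k : ℕ) (t : Fin 5 → ℤ) :
    PhiZ e₁ (Function.update e 0 k) t = PhiZ e₁ e t := by
  unfold PhiZ; rw [nExpZ_update0, cExp_update0]

/-- Exponents after the move in `e₁`. -/
theorem nExpZ_succ (e₁ : ℤ) (e : Fin 7 → ℕ) (t : Fin 5 → ℤ) :
    nExpZ (e₁ + 1) e t = (nExpZ e₁ e t - delta 5 - delta 9) + delta 2 + delta 7 := by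
  ext k; simp only [Pi.add_apply, Pi.sub_apply]; fin_cases k <;> simp [nExpZ, delta] <;> omega

/-- Exponents of the second child of the move in `e₁`. -/
theorem nExpZ_sub (e₁ : ℤ) (e : Fin 7 → ℕ) (t : Fin 5 → ℤ) :
    nExpZ e₁ e (t - tUnit 2) = (nExpZ e₁ e t - delta 5 - delta 9) + delta 0 + delta 8 := by
  ext k; simp only [Pi.add_apply, Pi.sub_apply]; fin_cases k <;> simp [nExpZ, delta, tUnit] <;> omega

/-- **The same Pascal relation for `PhiZ`** (Plücker move `E_move0`), for every `e₁ ∈ ℤ`. -/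
theorem PhiZ_succ (e₁ : ℤ) (e : Fin 7 → ℕ) (t : Fin 5 → ℤ) :
    PhiZ (e₁ + 1) e t = PhiZ e₁ e t + PhiZ e₁ e (t - tUnit 2) := by
  have hn : nExpZ e₁ e t - delta 5 - delta 9 + delta 5 + delta 9 = nExpZ e₁ e t := by abel
  unfold PhiZ
  rw [nExpZ_succ, E_move0, coeffZ_add, mul_assoc, coeffZ_X_mul, coeffZ_X_mul, hn, nExpZ_sub, cExp_sub0]

/-- `PhiZ` vanishes when `t₁ + t₃ < 0` (the `r₄`-target exponent is negative). -/
theorem PhiZ_eq_zero_of_neg (e₁ : ℤ) (e : Fin 7 → ℕ) {t : Fin 5 → ℤ} (h : t 0 + t 2 < 0) : PhiZ e₁ e t = 0 := by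
  unfold PhiZ
  exact coeffZ_eq_zero_of_neg _ (j := 3) (by simp [cExp]; omega)

/-! ## `Gz = PhiZ` everywhere -/

/-- Non-negative `e₁`: the landed twelve-parameter identity. -/
theorem Gz_eq_PhiZ_nat (n : ℕ) (e : Fin 7 → ℕ) (t : Fin 5 → ℤ) : Gz n e t = PhiZ n e t := by
  have h1 := Gz_natCast (Function.update e 0 n) t
  have h2 := PhiZ_natCast (Function.update e 0 n) t
  simp only [Function.update_self, Gz_update0, PhiZ_update0] at h1 h2
  rw [h1, h2, G_eq_Phi_of_base dualBaseIdentity_holds]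

/-- Negative `e₁ = −n`: induction on `n` (outer) and on `t₁ + t₃` (inner), running both relations backwards. -/
theorem Gz_eq_PhiZ_neg (n : ℕ) : ∀ (e : Fin 7 → ℕ) (t : Fin 5 → ℤ), Gz (-(n : ℤ)) e t = PhiZ (-(n : ℤ)) e t := by
  induction n with
  | zero => intro e t; exact_mod_cast Gz_eq_PhiZ_nat 0 e t
  | succ n ih =>
    intro e
    suffices H : ∀ (M : ℕ) (t : Fin 5 → ℤ), t 0 + t 2 < M → Gz (-((n + 1 : ℕ) : ℤ)) e t = PhiZ (-((n + 1 : ℕ) : ℤ)) e t from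
      fun t => H ((t 0 + t 2).toNat + 1) t (by omega)
    intro M
    induction M with
    | zero =>
      intro t ht
      have h0 : t 0 < 0 ∨ t 2 < 0 := by omega
      rw [PhiZ_eq_zero_of_neg _ _ (by omega)]
      rcases h0 with h0 | h0
      · exact Gz_eq_zero_of_neg _ _ h0
      · exact Gz_eq_zero_of_neg _ _ h0
    | succ M ihM =>
      intro t ht
      have hs : -((n + 1 : ℕ) : ℤ) + 1 = -(n : ℤ) := by push_cast; ring
      have hG := Gz_succ (-((n + 1 : ℕ) : ℤ)) e t
      have hP := PhiZ_succ (-((n + 1 : ℕ) : ℤ)) e t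
      rw [hs] at hG hP
      have h2 : Gz (-((n + 1 : ℕ) : ℤ)) e (t - tUnit 2) = PhiZ (-((n + 1 : ℕ) : ℤ)) e (t - tUnit 2) :=
        ihM _ (by simp [tUnit]; omega)
      have h1 := ih e t
      linarith

/-- **`Gz = PhiZ` on `ℤ × ℕ⁶ × ℤ⁵`.** -/
theorem Gz_eq_PhiZ (e₁ : ℤ) (e : Fin 7 → ℕ) (t : Fin 5 → ℤ) : Gz e₁ e t = PhiZ e₁ e t := by
  obtain ⟨n, rfl | rfl⟩ := Int.eq_nat_or_neg e₁
  · exact Gz_eq_PhiZ_nat n e t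
  · exact Gz_eq_PhiZ_neg n e t

end DualR

end Summit.KontsevichZagierPeriods.Zeta5Search.Families.Cellular
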